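import Literature.NumberTheory.LFunctions.FordZetaBoundKappa
import HarnessLib

/-!
# The `κ`-lemma with `C = 12` (banked slack for the explicit exponential-sum constant)

Topic `Literature/NumberTheory/LFunctions`.  Everything in this file is PROVED; no definition and
no named fact is introduced.

`FordZetaBoundKappa.lean` certifies, for the deduction "Ford's Theorem 2 ⟹ Theorem 1"
(`FordZetaBoundMain.lean`), that `κ(y) = e^{−2y³}∫_0^{u*} e^{3y²u} du + C ∫_{u*}^{∞} e^{−(u−y)²(u+2y)} du ≤ 10`
with Ford's `C = 9.463` and `u* = 13/10`.  Here the same bound `≤ 10` is certified with the LARGER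
constant `C = 12` (and `u* = 34/25`, where `12 e^{−u³}` crosses `1`): twenty-five `y`-cells, the
Gaussian comparisons of the previous file with `13/10 → 34/25`, and one sharper majorant for the
piece `u* ≤ u ≤ y` (`e^{−x} ≤ 1 − x + x²/2`, so `∫_0^d e^{−mv²} dv ≤ d − md³/3 + m²d⁵/10`,
`FordVK.integral_gaussian_trunc_le`).  The true supremum is `≈ 8.84` (near `y = 1.8`).

Purpose: an assembly `zeta_bound_ford` from an exponential-sum bound
`S(N,t) ≤ 12 · N^{1−1/(133.66λ²)}` (instead of Ford's `9.463`), leaving room in the constants of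
Ford's §§5–6 for weaker prime-number inputs (Bertrand/Chebyshev in place of Rosser–Schoenfeld) and
cruder constants in the mean-value iterations; the final constant of Theorem 1 is unchanged
(`(2 + e^{(34/25)³} + 2·12)/300^{2/3} + 10 · 5.113 · 1.443 < 74.7 ≤ 76.2`).

## References

* K. Ford, *Vinogradov's integral and bounds for the Riemann zeta function*, Proc. London Math.
  Soc. (3) 85 (2002), 565–633; arXiv:1910.08209. Lemma 7.3 and the proof of Theorem 1 (§7).
  [Ford2002]
-/

noncomputable section

open Real MeasureTheory Set intervalIntegral

namespace Literature.NumberTheory.LFunctions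

namespace FordVK

/-! ## The two terms of `κ(y)` with `u* = 34/25` -/

/-- First term, small `y`: for `0 ≤ y ≤ y₁`,
`e^{−2y³} ∫_0^{34/25} e^{3y²u} du ≤ (e^{3y₁²·(34/25)} − 1)/(3y₁²)`. [folklore] -/
theorem term1_le_of_le_us {y y₁ : ℝ} (hy : 0 ≤ y) (hy₁ : y ≤ y₁) (hy₁0 : 0 < y₁) :
    Real.exp (-2 * y ^ 3) * ∫ u in (0 : ℝ)..34 / 25, Real.exp (3 * y ^ 2 * u)
      ≤ (Real.exp (3 * y₁ ^ 2 * (34 / 25)) - 1) / (3 * y₁ ^ 2) := by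
  have hI0 : 0 ≤ ∫ u in (0 : ℝ)..34 / 25, Real.exp (3 * y ^ 2 * u) :=
    integral_nonneg (by norm_num) fun u _ ↦ (Real.exp_pos _).le
  have h1 : Real.exp (-2 * y ^ 3) ≤ 1 := by
    rw [Real.exp_le_one_iff]; nlinarith [pow_nonneg hy 3]
  have h2 : ∫ u in (0 : ℝ)..34 / 25, Real.exp (3 * y ^ 2 * u)
      ≤ ∫ u in (0 : ℝ)..34 / 25, Real.exp (3 * y₁ ^ 2 * u) := by
    refine integral_mono_on (by norm_num)
      ((by fun_prop : Continuous fun u ↦ Real.exp (3 * y ^ 2 * u)).intervalIntegrable _ _)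
      ((by fun_prop : Continuous fun u ↦ Real.exp (3 * y₁ ^ 2 * u)).intervalIntegrable _ _) ?_
    intro u hu
    apply Real.exp_le_exp.2
    have : y ^ 2 ≤ y₁ ^ 2 := pow_le_pow_left₀ hy hy₁ 2
    nlinarith [hu.1]
  have h3 := integral_exp_const_mul (k := 3 * y₁ ^ 2) (by positivity) (34 / 25)
  calc Real.exp (-2 * y ^ 3) * ∫ u in (0 : ℝ)..34 / 25, Real.exp (3 * y ^ 2 * u)
      ≤ 1 * ∫ u in (0 : ℝ)..34 / 25, Real.exp (3 * y ^ 2 * u) :=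
        mul_le_mul_of_nonneg_right h1 hI0
    _ ≤ _ := by rw [one_mul, ← h3]; exact h2
/-- First term, `y ≥ y₀ > 0`: `e^{−2y³} ∫_0^{34/25} e^{3y²u} du ≤ e^{(34/25)³}/(3y₀²)`, by
`e^{3y²u* − 2y³} ≤ e^{u*³}` (`u*³ − 3u*y² + 2y³ = (u* − y)²(u* + 2y) ≥ 0`). [folklore] -/
theorem term1_le_of_ge_us {y y₀ : ℝ} (hy₀ : 0 < y₀) (hy : y₀ ≤ y) :
    Real.exp (-2 * y ^ 3) * ∫ u in (0 : ℝ)..34 / 25, Real.exp (3 * y ^ 2 * u)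
      ≤ Real.exp ((34 / 25) ^ 3) / (3 * y₀ ^ 2) := by
  have hy' : 0 < y := hy₀.trans_le hy
  have hk : 0 < 3 * y ^ 2 := by positivity
  have h1 := integral_exp_const_mul_le hk (34 / 25)
  have h2 : Real.exp (-2 * y ^ 3) * (Real.exp (3 * y ^ 2 * (34 / 25)) / (3 * y ^ 2))
      = Real.exp (3 * y ^ 2 * (34 / 25) - 2 * y ^ 3) / (3 * y ^ 2) := by
    rw [mul_div_assoc', ← Real.exp_add]; ring_nf
  have h3 : Real.exp (3 * y ^ 2 * (34 / 25) - 2 * y ^ 3) ≤ Real.exp ((34 / 25) ^ 3) := by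
    apply Real.exp_le_exp.2
    nlinarith [mul_nonneg (sq_nonneg (34 / 25 - y)) (by linarith : 0 ≤ 34 / 25 + 2 * y)]
  calc Real.exp (-2 * y ^ 3) * ∫ u in (0 : ℝ)..34 / 25, Real.exp (3 * y ^ 2 * u)
      ≤ Real.exp (-2 * y ^ 3) * (Real.exp (3 * y ^ 2 * (34 / 25)) / (3 * y ^ 2)) :=
        mul_le_mul_of_nonneg_left h1 (Real.exp_pos _).le
    _ = Real.exp (3 * y ^ 2 * (34 / 25) - 2 * y ^ 3) / (3 * y ^ 2) := h2
    _ ≤ Real.exp ((34 / 25) ^ 3) / (3 * y ^ 2) := div_le_div_of_nonneg_right h3 hk.le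
    _ ≤ Real.exp ((34 / 25) ^ 3) / (3 * y₀ ^ 2) := by
        apply div_le_div_of_nonneg_left (Real.exp_pos _).le (by positivity)
        nlinarith [mul_pos hy₀ hy']
/-- First term, `y ≥ y₀ ≥ 13/10`: `e^{−2y³} ∫_0^{34/25} e^{3y²u} du ≤ e^{3y₀²u* − 2y₀³}/(3y₀²)`
(`p(y) = 3y²u* − 2y³` is non-increasing on `[u*, ∞)`). [folklore] -/
theorem term1_le_of_gep_us {y y₀ : ℝ} (hy₀ : 34 / 25 ≤ y₀) (hy : y₀ ≤ y) :
    Real.exp (-2 * y ^ 3) * ∫ u in (0 : ℝ)..34 / 25, Real.exp (3 * y ^ 2 * u)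
      ≤ Real.exp (3 * y₀ ^ 2 * (34 / 25) - 2 * y₀ ^ 3) / (3 * y₀ ^ 2) := by
  have hy₀' : 0 < y₀ := by linarith
  have hy' : 0 < y := hy₀'.trans_le hy
  have hk : 0 < 3 * y ^ 2 := by positivity
  have h1 := integral_exp_const_mul_le hk (34 / 25)
  have h2 : Real.exp (-2 * y ^ 3) * (Real.exp (3 * y ^ 2 * (34 / 25)) / (3 * y ^ 2))
      = Real.exp (3 * y ^ 2 * (34 / 25) - 2 * y ^ 3) / (3 * y ^ 2) := by
    rw [mul_div_assoc', ← Real.exp_add]; ring_nf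
  have h3 : Real.exp (3 * y ^ 2 * (34 / 25) - 2 * y ^ 3)
      ≤ Real.exp (3 * y₀ ^ 2 * (34 / 25) - 2 * y₀ ^ 3) := by
    apply Real.exp_le_exp.2
    have hA : 0 ≤ y - y₀ := by linarith
    have hB : 0 ≤ 2 * (y₀ ^ 2 + y₀ * y + y ^ 2) - 3 * (34 / 25) * (y₀ + y) := by
      nlinarith [mul_nonneg (by linarith : 0 ≤ y₀ - 34 / 25) hy₀'.le,
        mul_nonneg (by linarith : 0 ≤ y - 34 / 25) hy'.le,
        mul_nonneg (by linarith : 0 ≤ y₀ - 34 / 25) hy'.le,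
        mul_nonneg (by linarith : 0 ≤ y - 34 / 25) hy₀'.le]
    nlinarith [mul_nonneg hA hB]
  calc Real.exp (-2 * y ^ 3) * ∫ u in (0 : ℝ)..34 / 25, Real.exp (3 * y ^ 2 * u)
      ≤ Real.exp (-2 * y ^ 3) * (Real.exp (3 * y ^ 2 * (34 / 25)) / (3 * y ^ 2)) :=
        mul_le_mul_of_nonneg_left h1 (Real.exp_pos _).le
    _ = Real.exp (3 * y ^ 2 * (34 / 25) - 2 * y ^ 3) / (3 * y ^ 2) := h2
    _ ≤ Real.exp (3 * y₀ ^ 2 * (34 / 25) - 2 * y₀ ^ 3) / (3 * y ^ 2) :=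
        div_le_div_of_nonneg_right h3 hk.le
    _ ≤ Real.exp (3 * y₀ ^ 2 * (34 / 25) - 2 * y₀ ^ 3) / (3 * y₀ ^ 2) := by
        apply div_le_div_of_nonneg_left (Real.exp_pos _).le (by positivity)
        nlinarith [mul_pos hy₀' hy']
/-- Pointwise comparison on `u ≥ 13/10`: `(u − y)²(u + 2y) ≥ (34/25 + 2y)(u − y)²`, in exponential
form. [folklore] -/
theorem exp_neg_phi_le_gauss_us {y u : ℝ} (hu : 34 / 25 ≤ u) :
    Real.exp (-((u - y) ^ 2 * (u + 2 * y))) ≤ Real.exp (-(34 / 25 + 2 * y) * (u - y) ^ 2) := by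
  apply Real.exp_le_exp.2
  nlinarith [mul_nonneg (sq_nonneg (u - y)) (by linarith : (0 : ℝ) ≤ u - 34 / 25)]
/-- Second term on a cell `y₀ ≤ y ≤ y₁ ≤ 13/10`, Gaussian form:
`∫_{34/25}^{V} e^{−(u−y)²(u+2y)} du ≤ √(π/(34/25 + 2y₀))/2`. [folklore] -/
theorem term2_le_gauss_of_le_us {y y₀ V : ℝ} (hy₀ : 0 ≤ y₀) (hy : y₀ ≤ y) (hy₁ : y ≤ 34 / 25)
    (hV : 34 / 25 ≤ V) :
    ∫ u in (34 / 25 : ℝ)..V, Real.exp (-((u - y) ^ 2 * (u + 2 * y)))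
      ≤ Real.sqrt (π / (34 / 25 + 2 * y₀)) / 2 := by
  have hyy : 0 ≤ y := hy₀.trans hy
  set m : ℝ := 34 / 25 + 2 * y with hm
  have hm0 : 0 < m := by rw [hm]; linarith
  have h1 : ∫ u in (34 / 25 : ℝ)..V, Real.exp (-((u - y) ^ 2 * (u + 2 * y)))
      ≤ ∫ u in (34 / 25 : ℝ)..V, Real.exp (-m * (u - y) ^ 2) := by
    refine integral_mono_on hV
      ((by fun_prop : Continuous fun u ↦ Real.exp (-((u - y) ^ 2 * (u + 2 * y)))).intervalIntegrable _ _)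
      ((by fun_prop : Continuous fun u ↦ Real.exp (-m * (u - y) ^ 2)).intervalIntegrable _ _) ?_
    intro u hu
    exact exp_neg_phi_le_gauss_us hu.1
  have h2 : ∫ u in (34 / 25 : ℝ)..V, Real.exp (-m * (u - y) ^ 2)
      = ∫ v in (34 / 25 - y : ℝ)..V - y, Real.exp (-m * v ^ 2) :=
    intervalIntegral.integral_comp_sub_right (fun v ↦ Real.exp (-m * v ^ 2)) y
  have h3 := integral_gaussian_piece_le hm0 (d := 34 / 25 - y) (e := V - y) (by linarith) (by linarith)
  have h4 : Real.sqrt (π / m) ≤ Real.sqrt (π / (34 / 25 + 2 * y₀)) := by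
    apply Real.sqrt_le_sqrt
    exact div_le_div_of_nonneg_left Real.pi_pos.le (by linarith) (by rw [hm]; linarith)
  linarith
/-- Second term on a cell `0 ≤ y₀ ≤ y ≤ y₁ < 13/10`, tail form:
`∫_{34/25}^{V} e^{−(u−y)²(u+2y)} du ≤ e^{−m₀ d₁²}/(2 m₀ d₁)`, `m₀ = 34/25 + 2y₀`, `d₁ = 34/25 − y₁`.
[folklore] -/
theorem term2_le_tail_of_le_us {y y₀ y₁ V : ℝ} (hy₀ : 0 ≤ y₀) (hy : y₀ ≤ y) (hy' : y ≤ y₁)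
    (hy₁ : y₁ < 34 / 25) (hV : 34 / 25 ≤ V) :
    ∫ u in (34 / 25 : ℝ)..V, Real.exp (-((u - y) ^ 2 * (u + 2 * y)))
      ≤ Real.exp (-(34 / 25 + 2 * y₀) * (34 / 25 - y₁) ^ 2)
          / (2 * (34 / 25 + 2 * y₀) * (34 / 25 - y₁)) := by
  have hyy : 0 ≤ y := hy₀.trans hy
  set m : ℝ := 34 / 25 + 2 * y with hm
  have hm0 : 0 < m := by rw [hm]; linarith
  set d : ℝ := 34 / 25 - y with hd
  have hd0 : 0 < d := by rw [hd]; linarith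
  have h1 : ∫ u in (34 / 25 : ℝ)..V, Real.exp (-((u - y) ^ 2 * (u + 2 * y)))
      ≤ ∫ u in (34 / 25 : ℝ)..V, Real.exp (-m * (u - y) ^ 2) := by
    refine integral_mono_on hV
      ((by fun_prop : Continuous fun u ↦ Real.exp (-((u - y) ^ 2 * (u + 2 * y)))).intervalIntegrable _ _)
      ((by fun_prop : Continuous fun u ↦ Real.exp (-m * (u - y) ^ 2)).intervalIntegrable _ _) ?_
    intro u hu
    exact exp_neg_phi_le_gauss_us hu.1
  have h2 : ∫ u in (34 / 25 : ℝ)..V, Real.exp (-m * (u - y) ^ 2)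
      = ∫ v in (34 / 25 - y : ℝ)..V - y, Real.exp (-m * v ^ 2) :=
    intervalIntegral.integral_comp_sub_right (fun v ↦ Real.exp (-m * v ^ 2)) y
  have h3 := integral_gaussian_tail_le hm0 (d := d) (e := V - y) hd0 (by rw [hd]; linarith)
  -- monotonicity in the cell: `m ≥ m₀`, `d ≥ d₁`
  set m₀ : ℝ := 34 / 25 + 2 * y₀ with hm₀
  set d₁ : ℝ := 34 / 25 - y₁ with hd₁
  have hm₀0 : 0 < m₀ := by rw [hm₀]; linarith
  have hd₁0 : 0 < d₁ := by rw [hd₁]; linarith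
  have hmm : m₀ ≤ m := by rw [hm₀, hm]; linarith
  have hdd : d₁ ≤ d := by rw [hd₁, hd]; linarith
  have h4 : Real.exp (-m * d ^ 2) ≤ Real.exp (-m₀ * d₁ ^ 2) := by
    apply Real.exp_le_exp.2
    have : d₁ ^ 2 ≤ d ^ 2 := pow_le_pow_left₀ hd₁0.le hdd 2
    nlinarith [mul_le_mul hmm this (by positivity) hm0.le]
  have h5 : 2 * m₀ * d₁ ≤ 2 * m * d := by nlinarith [mul_le_mul hmm hdd hd₁0.le hm0.le]
  have h6 : Real.exp (-m * d ^ 2) / (2 * m * d) ≤ Real.exp (-m₀ * d₁ ^ 2) / (2 * m₀ * d₁) :=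
    div_le_div₀ (Real.exp_pos _).le h4 (by positivity) h5
  have e13 : (34 / 25 - y : ℝ) = d := by rw [hd]
  rw [e13] at h2
  linarith
/-- Second term on a cell `34/25 ≤ y₀ ≤ y ≤ y₁`: splitting the integral at `u = y`,
`∫_{34/25}^{V} e^{−(u−y)²(u+2y)} du ≤ min(y₁ − 34/25, √(π/(34/25+2y₀))/2) + √(π/(3y₀))/2`; here
the form with both alternatives as separate conclusions. [folklore] -/
theorem term2_le_of_ge_us {y y₀ y₁ V : ℝ} (hy₀ : 34 / 25 ≤ y₀) (hy : y₀ ≤ y) (hy' : y ≤ y₁)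
    (hV : 34 / 25 ≤ V) :
    ∫ u in (34 / 25 : ℝ)..V, Real.exp (-((u - y) ^ 2 * (u + 2 * y)))
        ≤ (y₁ - 34 / 25) + Real.sqrt (π / (3 * y₀)) / 2
      ∧ ∫ u in (34 / 25 : ℝ)..V, Real.exp (-((u - y) ^ 2 * (u + 2 * y)))
        ≤ Real.sqrt (π / (34 / 25 + 2 * y₀)) / 2 + Real.sqrt (π / (3 * y₀)) / 2 := by
  have hy13 : 34 / 25 ≤ y := hy₀.trans hy
  have hyy : 0 ≤ y := by linarith
  have hy0' : 0 < y := by linarith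
  set f : ℝ → ℝ := fun u ↦ Real.exp (-((u - y) ^ 2 * (u + 2 * y))) with hf
  have hfc : Continuous f := by rw [hf]; fun_prop
  have hf0 : ∀ u, 0 ≤ f u := fun u ↦ (Real.exp_pos _).le
  set V' : ℝ := max V y with hV'
  -- enlarge the interval to `[13/10, V']` and split at `y`
  have hmono : ∫ u in (34 / 25 : ℝ)..V, f u ≤ ∫ u in (34 / 25 : ℝ)..V', f u :=
    integral_mono_interval le_rfl hV (le_max_left _ _)
      (Filter.Eventually.of_forall fun u ↦ hf0 u) (hfc.intervalIntegrable _ _)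
  have hsplit : ∫ u in (34 / 25 : ℝ)..V', f u = (∫ u in (34 / 25 : ℝ)..y, f u) + ∫ u in y..V', f u :=
    (integral_add_adjacent_intervals (hfc.intervalIntegrable _ _) (hfc.intervalIntegrable _ _)).symm
  -- piece 1, Gaussian comparison with `m = 34/25 + 2y`
  set m : ℝ := 34 / 25 + 2 * y with hm
  have hm0 : 0 < m := by rw [hm]; linarith
  have hp1 : ∫ u in (34 / 25 : ℝ)..y, f u ≤ ∫ u in (34 / 25 : ℝ)..y, Real.exp (-m * (u - y) ^ 2) := by
    refine integral_mono_on hy13 (hfc.intervalIntegrable _ _)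
      ((by fun_prop : Continuous fun u ↦ Real.exp (-m * (u - y) ^ 2)).intervalIntegrable _ _) ?_
    intro u hu
    exact exp_neg_phi_le_gauss_us hu.1
  have hp1a : ∫ u in (34 / 25 : ℝ)..y, Real.exp (-m * (u - y) ^ 2) ≤ y₁ - 34 / 25 := by
    have : ∫ u in (34 / 25 : ℝ)..y, Real.exp (-m * (u - y) ^ 2) ≤ ∫ u in (34 / 25 : ℝ)..y, (1 : ℝ) := by
      refine integral_mono_on hy13
        ((by fun_prop : Continuous fun u ↦ Real.exp (-m * (u - y) ^ 2)).intervalIntegrable _ _)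
        (continuous_const.intervalIntegrable _ _) ?_
      intro u _
      rw [Real.exp_le_one_iff]
      nlinarith [sq_nonneg (u - y)]
    rw [intervalIntegral.integral_const, smul_eq_mul, mul_one] at this
    linarith
  have hp1b : ∫ u in (34 / 25 : ℝ)..y, Real.exp (-m * (u - y) ^ 2)
      ≤ Real.sqrt (π / (34 / 25 + 2 * y₀)) / 2 := by
    have e1 : ∫ u in (34 / 25 : ℝ)..y, Real.exp (-m * (u - y) ^ 2)
        = ∫ v in (34 / 25 - y : ℝ)..y - y, Real.exp (-m * v ^ 2) :=
      intervalIntegral.integral_comp_sub_right (fun v ↦ Real.exp (-m * v ^ 2)) y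
    have e2 : ∫ v in (34 / 25 - y : ℝ)..y - y, Real.exp (-m * v ^ 2)
        = ∫ w in (-(y - y) : ℝ)..-(34 / 25 - y), Real.exp (-m * w ^ 2) := by
      rw [← intervalIntegral.integral_comp_neg (fun w ↦ Real.exp (-m * w ^ 2))]
      refine integral_congr fun w _ ↦ ?_
      simp only [even_two, Even.neg_pow]
    have e3 := integral_gaussian_piece_le hm0 (d := -(y - y)) (e := -(34 / 25 - y)) (by simp) (by linarith)
    have h4 : Real.sqrt (π / m) ≤ Real.sqrt (π / (34 / 25 + 2 * y₀)) := by
      apply Real.sqrt_le_sqrt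
      exact div_le_div_of_nonneg_left Real.pi_pos.le (by linarith) (by rw [hm]; linarith)
    linarith
  -- piece 2, Gaussian comparison with `m' = 3y`
  have hp2 : ∫ u in y..V', f u ≤ Real.sqrt (π / (3 * y₀)) / 2 := by
    have hyV' : y ≤ V' := le_max_right _ _
    have h1 : ∫ u in y..V', f u ≤ ∫ u in y..V', Real.exp (-(3 * y) * (u - y) ^ 2) := by
      refine integral_mono_on hyV' (hfc.intervalIntegrable _ _)
        ((by fun_prop : Continuous fun u ↦ Real.exp (-(3 * y) * (u - y) ^ 2)).intervalIntegrable _ _) ?_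
      intro u hu
      exact exp_neg_phi_le_gauss' hu.1
    have e1 : ∫ u in y..V', Real.exp (-(3 * y) * (u - y) ^ 2)
        = ∫ v in (y - y : ℝ)..V' - y, Real.exp (-(3 * y) * v ^ 2) :=
      intervalIntegral.integral_comp_sub_right (fun v ↦ Real.exp (-(3 * y) * v ^ 2)) y
    have e3 := integral_gaussian_piece_le (m := 3 * y) (by positivity) (d := y - y) (e := V' - y)
      (by simp) (by linarith)
    have h4 : Real.sqrt (π / (3 * y)) ≤ Real.sqrt (π / (3 * y₀)) := by
      apply Real.sqrt_le_sqrt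
      exact div_le_div_of_nonneg_left Real.pi_pos.le (by linarith) (by linarith)
    linarith
  constructor <;> linarith

/-! ## A sharper majorant for the truncated Gaussian piece -/

/-- `e^{−x} ≤ 1 − x + x²/2` for `x ≥ 0`. [folklore] -/
theorem exp_neg_le_taylor2 {x : ℝ} (hx : 0 ≤ x) : Real.exp (-x) ≤ 1 - x + x ^ 2 / 2 := by
  have hmono : MonotoneOn (fun x : ℝ ↦ 1 - x + x ^ 2 / 2 - Real.exp (-x)) (Set.Ici 0) := by
    refine monotoneOn_of_hasDerivWithinAt_nonneg (convex_Ici 0)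
      (f' := fun x ↦ -1 + x + Real.exp (-x)) (by fun_prop : Continuous _).continuousOn ?_ ?_
    · intro x _
      have h1 : HasDerivAt (fun x : ℝ ↦ 1 - x + x ^ 2 / 2) (-1 + x) x := by
        have := (((hasDerivAt_id x).const_sub 1).add ((hasDerivAt_pow 2 x).div_const 2))
        exact this.congr_deriv (by simp)
      have h2 : HasDerivAt (fun x : ℝ ↦ Real.exp (-x)) (-Real.exp (-x)) x := by
        have := (hasDerivAt_neg x).exp
        exact this.congr_deriv (by ring)
      exact (h1.sub h2).hasDerivWithinAt.congr_deriv (by ring)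
    · intro x _
      have := Real.add_one_le_exp (-x)
      linarith
  have h := hmono (Set.mem_Ici.2 le_rfl) (Set.mem_Ici.2 hx) hx
  simp only [neg_zero, Real.exp_zero] at h
  linarith

/-- **Truncated Gaussian**: `∫_0^d e^{−mv²} dv ≤ d − m d³/3 + m² d⁵/10` (`m, d ≥ 0`). [folklore] -/
theorem integral_gaussian_trunc_le {m d : ℝ} (hm : 0 ≤ m) (hd : 0 ≤ d) :
    ∫ v in (0 : ℝ)..d, Real.exp (-m * v ^ 2) ≤ d - m * d ^ 3 / 3 + m ^ 2 * d ^ 5 / 10 := by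
  have hmono : ∫ v in (0 : ℝ)..d, Real.exp (-m * v ^ 2)
      ≤ ∫ v in (0 : ℝ)..d, (1 - m * v ^ 2 + m ^ 2 * v ^ 4 / 2) := by
    refine integral_mono_on hd
      ((by fun_prop : Continuous fun v ↦ Real.exp (-m * v ^ 2)).intervalIntegrable _ _)
      ((by fun_prop : Continuous fun v : ℝ ↦ 1 - m * v ^ 2 + m ^ 2 * v ^ 4 / 2).intervalIntegrable _ _)
      fun v _ ↦ ?_
    have := exp_neg_le_taylor2 (x := m * v ^ 2) (by positivity)
    calc Real.exp (-m * v ^ 2) = Real.exp (-(m * v ^ 2)) := by ring_nf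
      _ ≤ 1 - m * v ^ 2 + (m * v ^ 2) ^ 2 / 2 := this
      _ = 1 - m * v ^ 2 + m ^ 2 * v ^ 4 / 2 := by ring
  have hderiv : ∀ x ∈ uIcc 0 d, HasDerivAt (fun v ↦ v - m * v ^ 3 / 3 + m ^ 2 * v ^ 5 / 10)
      (1 - m * x ^ 2 + m ^ 2 * x ^ 4 / 2) x := by
    intro x _
    have := ((hasDerivAt_id x).sub (((hasDerivAt_pow 3 x).const_mul m).div_const 3)).add
      (((hasDerivAt_pow 5 x).const_mul (m ^ 2)).div_const 10)
    exact this.congr_deriv (by simp; ring)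
  rw [integral_eq_sub_of_hasDerivAt hderiv
    ((by fun_prop : Continuous fun v : ℝ ↦ 1 - m * v ^ 2 + m ^ 2 * v ^ 4 / 2).intervalIntegrable _ _)] at hmono
  simpa using hmono

/-- Second term on a cell `34/25 ≤ y₀ ≤ y ≤ y₁`, with the truncated-Gaussian majorant for the piece
`34/25 ≤ u ≤ y`: `∫_{34/25}^{V} e^{−(u−y)²(u+2y)} du ≤ (d₁ − m₀d₁³/3 + m₀²d₁⁵/10) + √(π/(3y₀))/2`,
`d₁ = y₁ − 34/25`, `m₀ = 34/25 + 2y₀`. [folklore] -/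
theorem term2_le_of_ge_taylor_us {y y₀ y₁ V : ℝ} (hy₀ : 34 / 25 ≤ y₀) (hy : y₀ ≤ y) (hy' : y ≤ y₁)
    (hV : 34 / 25 ≤ V) :
    ∫ u in (34 / 25 : ℝ)..V, Real.exp (-((u - y) ^ 2 * (u + 2 * y)))
      ≤ ((y₁ - 34 / 25) - (34 / 25 + 2 * y₀) * (y₁ - 34 / 25) ^ 3 / 3
          + (34 / 25 + 2 * y₀) ^ 2 * (y₁ - 34 / 25) ^ 5 / 10)
        + Real.sqrt (π / (3 * y₀)) / 2 := by
  have hy13 : 34 / 25 ≤ y := hy₀.trans hy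
  have hyy : 0 ≤ y := by linarith
  set f : ℝ → ℝ := fun u ↦ Real.exp (-((u - y) ^ 2 * (u + 2 * y))) with hf
  have hfc : Continuous f := by rw [hf]; fun_prop
  have hf0 : ∀ u, 0 ≤ f u := fun u ↦ (Real.exp_pos _).le
  set V' : ℝ := max V y with hV'
  have hmonoV : ∫ u in (34 / 25 : ℝ)..V, f u ≤ ∫ u in (34 / 25 : ℝ)..V', f u :=
    integral_mono_interval le_rfl hV (le_max_left _ _)
      (Filter.Eventually.of_forall fun u ↦ hf0 u) (hfc.intervalIntegrable _ _)
  have hsplit : ∫ u in (34 / 25 : ℝ)..V', f u = (∫ u in (34 / 25 : ℝ)..y, f u) + ∫ u in y..V', f u :=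
    (integral_add_adjacent_intervals (hfc.intervalIntegrable _ _) (hfc.intervalIntegrable _ _)).symm
  -- piece 1
  set m : ℝ := 34 / 25 + 2 * y with hm
  set m₀ : ℝ := 34 / 25 + 2 * y₀ with hm₀
  set d₁ : ℝ := y₁ - 34 / 25 with hd₁
  have hm₀0 : 0 < m₀ := by rw [hm₀]; linarith
  have hmm : m₀ ≤ m := by rw [hm₀, hm]; linarith
  have hd₁ge : y - 34 / 25 ≤ d₁ := by rw [hd₁]; linarith
  have hp1 : ∫ u in (34 / 25 : ℝ)..y, f u ≤ ∫ u in (34 / 25 : ℝ)..y, Real.exp (-m * (u - y) ^ 2) := by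
    refine integral_mono_on hy13 (hfc.intervalIntegrable _ _)
      ((by fun_prop : Continuous fun u ↦ Real.exp (-m * (u - y) ^ 2)).intervalIntegrable _ _) ?_
    intro u hu
    exact exp_neg_phi_le_gauss_us hu.1
  have e1 : ∫ u in (34 / 25 : ℝ)..y, Real.exp (-m * (u - y) ^ 2)
      = ∫ w in (0 : ℝ)..y - 34 / 25, Real.exp (-m * w ^ 2) := by
    rw [intervalIntegral.integral_comp_sub_right (fun v ↦ Real.exp (-m * v ^ 2)) y, sub_self]
    rw [show (∫ x in (34 / 25 - y : ℝ)..0, Real.exp (-m * x ^ 2))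
        = ∫ x in (34 / 25 - y : ℝ)..0, Real.exp (-m * (-x) ^ 2) by simp only [even_two, Even.neg_pow]]
    rw [intervalIntegral.integral_comp_neg (fun w ↦ Real.exp (-m * w ^ 2)), neg_zero, neg_sub]
  have e2 : ∫ w in (0 : ℝ)..y - 34 / 25, Real.exp (-m * w ^ 2)
      ≤ ∫ w in (0 : ℝ)..d₁, Real.exp (-m₀ * w ^ 2) := by
    calc ∫ w in (0 : ℝ)..y - 34 / 25, Real.exp (-m * w ^ 2)
        ≤ ∫ w in (0 : ℝ)..d₁, Real.exp (-m * w ^ 2) :=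
          integral_mono_interval le_rfl (by linarith) hd₁ge
            (Filter.Eventually.of_forall fun w ↦ (Real.exp_pos _).le)
            ((by fun_prop : Continuous fun w ↦ Real.exp (-m * w ^ 2)).intervalIntegrable _ _)
      _ ≤ ∫ w in (0 : ℝ)..d₁, Real.exp (-m₀ * w ^ 2) := by
          refine integral_mono_on (by linarith)
            ((by fun_prop : Continuous fun w ↦ Real.exp (-m * w ^ 2)).intervalIntegrable _ _)
            ((by fun_prop : Continuous fun w ↦ Real.exp (-m₀ * w ^ 2)).intervalIntegrable _ _) ?_
          intro w _
          apply Real.exp_le_exp.2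
          nlinarith [sq_nonneg w]
  have e3 := integral_gaussian_trunc_le hm₀0.le (d := d₁) (by linarith)
  -- piece 2
  have hp2 : ∫ u in y..V', f u ≤ Real.sqrt (π / (3 * y₀)) / 2 := by
    have hyV' : y ≤ V' := le_max_right _ _
    have h1 : ∫ u in y..V', f u ≤ ∫ u in y..V', Real.exp (-(3 * y) * (u - y) ^ 2) := by
      refine integral_mono_on hyV' (hfc.intervalIntegrable _ _)
        ((by fun_prop : Continuous fun u ↦ Real.exp (-(3 * y) * (u - y) ^ 2)).intervalIntegrable _ _) ?_
      intro u hu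
      exact exp_neg_phi_le_gauss' hu.1
    have e1 : ∫ u in y..V', Real.exp (-(3 * y) * (u - y) ^ 2)
        = ∫ v in (y - y : ℝ)..V' - y, Real.exp (-(3 * y) * v ^ 2) :=
      intervalIntegral.integral_comp_sub_right (fun v ↦ Real.exp (-(3 * y) * v ^ 2)) y
    have e3 := integral_gaussian_piece_le (m := 3 * y) (by positivity) (d := y - y) (e := V' - y)
      (by simp) (by linarith)
    have h4 : Real.sqrt (π / (3 * y)) ≤ Real.sqrt (π / (3 * y₀)) := by
      apply Real.sqrt_le_sqrt
      exact div_le_div_of_nonneg_left Real.pi_pos.le (by linarith) (by linarith)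
    linarith
  have : (y₁ - 34 / 25) - (34 / 25 + 2 * y₀) * (y₁ - 34 / 25) ^ 3 / 3
      + (34 / 25 + 2 * y₀) ^ 2 * (y₁ - 34 / 25) ^ 5 / 10 = d₁ - m₀ * d₁ ^ 3 / 3 + m₀ ^ 2 * d₁ ^ 5 / 10 := by
    rw [hd₁, hm₀]
  rw [this]
  linarith

/-! ## Numerical constant -/

/-- `e^{(34/25)³} = e^{2.515…} ≤ 12.38`. [folklore] -/
theorem exp_cube_us_le : Real.exp ((34 / 25) ^ 3) ≤ 12.38 := by
  have := VK.exp_le_of_expUB_le (k := 2) (f := (34 / 25 : ℝ) ^ 3 - 2) (X := 12.38) (by norm_num) (by norm_num)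
    (by norm_num [VK.expUB])
  convert this using 2; norm_num

/-! ## Numerical constants for the cells -/

/-- Numerical constant for the `κ₁₂` cell below `34/25` no. 0. [folklore] -/
theorem k12_expB_0 : Real.exp (3 * (3 / 5) ^ 2 * (34 / 25)) ≤ 4.348 := by
  have := VK.exp_le_of_expUB_le (k := 1) (f := 293/625) (X := 4.348) (by norm_num) (by norm_num)
    (by norm_num [VK.expUB])
  convert this using 2; norm_num

/-- Numerical constant for the `κ₁₂` cell below `34/25` no. 1. [folklore] -/
theorem k12_expB_1 : Real.exp (3 * (4 / 5) ^ 2 * (34 / 25)) ≤ 13.619 := by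
  have := VK.exp_le_of_expUB_le (k := 2) (f := 382/625) (X := 13.619) (by norm_num) (by norm_num)
    (by norm_num [VK.expUB])
  convert this using 2; norm_num

/-- Numerical constant for the `κ₁₂` cell above `34/25` no. 0. [folklore] -/
theorem k12_expA_0 : Real.exp (3 * (34 / 25) ^ 2 * (34 / 25) - 2 * (34 / 25) ^ 3) ≤ 12.376 := by
  have := VK.exp_le_of_expUB_le (k := 2) (f := 8054/15625) (X := 12.376) (by norm_num) (by norm_num)
    (by norm_num [VK.expUB])
  convert this using 2; norm_num

/-- Numerical constant for the `κ₁₂` cell above `34/25` no. 1. [folklore] -/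
theorem k12_expA_1 : Real.exp (3 * (29 / 20) ^ 2 * (34 / 25) - 2 * (29 / 20) ^ 3) ≤ 11.956 := by
  have := VK.exp_le_of_expUB_le (k := 2) (f := 9619/20000) (X := 11.956) (by norm_num) (by norm_num)
    (by norm_num [VK.expUB])
  convert this using 2; norm_num

/-- Numerical constant for the `κ₁₂` cell above `34/25` no. 2. [folklore] -/
theorem k12_expA_2 : Real.exp (3 * (3 / 2) ^ 2 * (34 / 25) - 2 * (3 / 2) ^ 3) ≤ 11.362 := by
  have := VK.exp_le_of_expUB_le (k := 2) (f := 43/100) (X := 11.362) (by norm_num) (by norm_num)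
    (by norm_num [VK.expUB])
  convert this using 2; norm_num

/-- Numerical constant for the `κ₁₂` cell above `34/25` no. 3. [folklore] -/
theorem k12_expA_3 : Real.exp (3 * (31 / 20) ^ 2 * (34 / 25) - 2 * (31 / 20) ^ 3) ≤ 10.536 := by
  have := VK.exp_le_of_expUB_le (k := 2) (f := 7089/20000) (X := 10.536) (by norm_num) (by norm_num)
    (by norm_num [VK.expUB])
  convert this using 2; norm_num

/-- Numerical constant for the `κ₁₂` cell above `34/25` no. 4. [folklore] -/
theorem k12_expA_4 : Real.exp (3 * (8 / 5) ^ 2 * (34 / 25) - 2 * (8 / 5) ^ 3) ≤ 9.518 := by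
  have := VK.exp_le_of_expUB_le (k := 2) (f := 158/625) (X := 9.518) (by norm_num) (by norm_num)
    (by norm_num [VK.expUB])
  convert this using 2; norm_num

/-- Numerical constant for the `κ₁₂` cell above `34/25` no. 5. [folklore] -/
theorem k12_expA_5 : Real.exp (3 * (33 / 20) ^ 2 * (34 / 25) - 2 * (33 / 20) ^ 3) ≤ 8.364 := by
  have := VK.exp_le_of_expUB_le (k := 2) (f := 2471/20000) (X := 8.364) (by norm_num) (by norm_num)
    (by norm_num [VK.expUB])
  convert this using 2; norm_num

/-- Numerical constant for the `κ₁₂` cell above `34/25` no. 6. [folklore] -/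
theorem k12_expA_6 : Real.exp (3 * (17 / 10) ^ 2 * (34 / 25) - 2 * (17 / 10) ^ 3) ≤ 7.140 := by
  have := VK.exp_le_of_expUB_le (k := 1) (f := 2413/2500) (X := 7.140) (by norm_num) (by norm_num)
    (by norm_num [VK.expUB])
  convert this using 2; norm_num

/-- Numerical constant for the `κ₁₂` cell above `34/25` no. 7. [folklore] -/
theorem k12_expA_7 : Real.exp (3 * (7 / 4) ^ 2 * (34 / 25) - 2 * (7 / 4) ^ 3) ≤ 5.911 := by
  have := VK.exp_le_of_expUB_le (k := 1) (f := 621/800) (X := 5.911) (by norm_num) (by norm_num)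
    (by norm_num [VK.expUB])
  convert this using 2; norm_num

/-- Numerical constant for the `κ₁₂` cell above `34/25` no. 8. [folklore] -/
theorem k12_expA_8 : Real.exp (3 * (9 / 5) ^ 2 * (34 / 25) - 2 * (9 / 5) ^ 3) ≤ 4.740 := by
  have := VK.exp_le_of_expUB_le (k := 1) (f := 347/625) (X := 4.740) (by norm_num) (by norm_num)
    (by norm_num [VK.expUB])
  convert this using 2; norm_num

/-- Numerical constant for the `κ₁₂` cell above `34/25` no. 9. [folklore] -/
theorem k12_expA_9 : Real.exp (3 * (37 / 20) ^ 2 * (34 / 25) - 2 * (37 / 20) ^ 3) ≤ 3.675 := by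
  have := VK.exp_le_of_expUB_le (k := 1) (f := 6011/20000) (X := 3.675) (by norm_num) (by norm_num)
    (by norm_num [VK.expUB])
  convert this using 2; norm_num

/-- Numerical constant for the `κ₁₂` cell above `34/25` no. 10. [folklore] -/
theorem k12_expA_10 : Real.exp (3 * (19 / 10) ^ 2 * (34 / 25) - 2 * (19 / 10) ^ 3) ≤ 2.751 := by
  have := VK.exp_le_of_expUB_le (k := 1) (f := 27/2500) (X := 2.751) (by norm_num) (by norm_num)
    (by norm_num [VK.expUB])
  convert this using 2; norm_num

/-- Numerical constant for the `κ₁₂` cell above `34/25` no. 11. [folklore] -/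
theorem k12_expA_11 : Real.exp (3 * (39 / 20) ^ 2 * (34 / 25) - 2 * (39 / 20) ^ 3) ≤ 1.986 := by
  have := VK.exp_le_of_expUB_le (k := 0) (f := 13689/20000) (X := 1.986) (by norm_num) (by norm_num)
    (by norm_num [VK.expUB])
  convert this using 2; norm_num

/-- Numerical constant for the `κ₁₂` cell above `34/25` no. 12. [folklore] -/
theorem k12_expA_12 : Real.exp (3 * (2) ^ 2 * (34 / 25) - 2 * (2) ^ 3) ≤ 1.381 := by
  have := VK.exp_le_of_expUB_le (k := 0) (f := 8/25) (X := 1.381) (by norm_num) (by norm_num)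
    (by norm_num [VK.expUB])
  convert this using 2; norm_num


/-! ## The `κ`-lemma with `C = 12` -/

/-- The `κ₁₂`-bound on the range no. 1 of `y`. [folklore] -/
theorem kappa12_le_part1 {y V : ℝ} (hy : 0 ≤ y) (hhi : y ≤ 34 / 25) (hV : 34 / 25 ≤ V) :
    Real.exp (-2 * y ^ 3) * (∫ u in (0 : ℝ)..34 / 25, Real.exp (3 * y ^ 2 * u))
      + 12 * ∫ u in (34 / 25 : ℝ)..V, Real.exp (-((u - y) ^ 2 * (u + 2 * y))) ≤ 10 := by
  have hEus := exp_cube_us_le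
  rcases le_or_gt y (3 / 5) with hc | hc
  · -- cell [0.0, 0.6]: P ≤ 3.1000, Q ≤ 0.2311, total 5.873
    have hP := term1_le_of_le_us hy hc (by norm_num)
    have hE := k12_expB_0
    have hP' : (Real.exp (3 * (3 / 5) ^ 2 * (34 / 25)) - 1) / (3 * (3 / 5) ^ 2) ≤ 3.1002 := by
      rw [div_le_iff₀ (by norm_num)]; linarith
    have hQ := term2_le_tail_of_le_us (by norm_num) hy hc (by norm_num) hV
    have hX : Real.exp (-(34 / 25 + 2 * (0)) * (34 / 25 - 3 / 5) ^ 2) ≤ 0.4777 := by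
      have := exp_neg_le_of_quadratic (c := 12274/15625) (X := 0.4777) (by norm_num) (by norm_num) (by norm_num)
      convert this using 2; norm_num
    have hQ' : Real.exp (-(34 / 25 + 2 * (0)) * (34 / 25 - 3 / 5) ^ 2)
        / (2 * (34 / 25 + 2 * (0)) * (34 / 25 - 3 / 5)) ≤ 0.2312 := by
      rw [div_le_iff₀ (by norm_num)]; linarith
    linarith
  have hprev := hc
  rcases le_or_gt y (4 / 5) with hc | hc
  · -- cell [0.6, 0.8]: P ≤ 6.5724, Q ≤ 0.1642, total 8.542
    have hP := term1_le_of_le_us hy hc (by norm_num)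
    have hE := k12_expB_1
    have hP' : (Real.exp (3 * (4 / 5) ^ 2 * (34 / 25)) - 1) / (3 * (4 / 5) ^ 2) ≤ 6.5725 := by
      rw [div_le_iff₀ (by norm_num)]; linarith
    have hQ := term2_le_tail_of_le_us (by norm_num) hprev.le hc (by norm_num) hV
    have hX : Real.exp (-(34 / 25 + 2 * (3 / 5)) * (34 / 25 - 4 / 5) ^ 2) ≤ 0.4707 := by
      have := exp_neg_le_of_quadratic (c := 12544/15625) (X := 0.4707) (by norm_num) (by norm_num) (by norm_num)
      convert this using 2; norm_num
    have hQ' : Real.exp (-(34 / 25 + 2 * (3 / 5)) * (34 / 25 - 4 / 5) ^ 2)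
        / (2 * (34 / 25 + 2 * (3 / 5)) * (34 / 25 - 4 / 5)) ≤ 0.1643 := by
      rw [div_le_iff₀ (by norm_num)]; linarith
    linarith
  have hprev := hc
  rcases le_or_gt y (19 / 20) with hc | hc
  · -- cell [0.8, 0.95]: P ≤ 6.4479, Q ≤ 0.2542, total 9.498
    have hP := term1_le_of_ge_us (by norm_num : (0 : ℝ) < 4 / 5) hprev.le
    have hP' : Real.exp ((34 / 25) ^ 3) / (3 * (4 / 5) ^ 2) ≤ 6.4481 := by
      rw [div_le_iff₀ (by norm_num)]; linarith [hEus]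
    have hQ := term2_le_tail_of_le_us (by norm_num) hprev.le hc (by norm_num) hV
    have hX : Real.exp (-(34 / 25 + 2 * (4 / 5)) * (34 / 25 - 19 / 20) ^ 2) ≤ 0.6169 := by
      have := exp_neg_le_of_quadratic (c := 62197/125000) (X := 0.6169) (by norm_num) (by norm_num) (by norm_num)
      convert this using 2; norm_num
    have hQ' : Real.exp (-(34 / 25 + 2 * (4 / 5)) * (34 / 25 - 19 / 20) ^ 2)
        / (2 * (34 / 25 + 2 * (4 / 5)) * (34 / 25 - 19 / 20)) ≤ 0.25429999999999997 := by
      rw [div_le_iff₀ (by norm_num)]; linarith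
    linarith
  have hprev := hc
  rcases le_or_gt y (21 / 20) with hc | hc
  · -- cell [0.95, 1.05]: P ≤ 4.5725, Q ≤ 0.3632, total 8.931
    have hP := term1_le_of_ge_us (by norm_num : (0 : ℝ) < 19 / 20) hprev.le
    have hP' : Real.exp ((34 / 25) ^ 3) / (3 * (19 / 20) ^ 2) ≤ 4.5725999999999996 := by
      rw [div_le_iff₀ (by norm_num)]; linarith [hEus]
    have hQ := term2_le_tail_of_le_us (by norm_num) hprev.le hc (by norm_num) hV
    have hX : Real.exp (-(34 / 25 + 2 * (19 / 20)) * (34 / 25 - 21 / 20) ^ 2) ≤ 0.7342 := by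
      have := exp_neg_le_of_quadratic (c := 156643/500000) (X := 0.7342) (by norm_num) (by norm_num) (by norm_num)
      convert this using 2; norm_num
    have hQ' : Real.exp (-(34 / 25 + 2 * (19 / 20)) * (34 / 25 - 21 / 20) ^ 2)
        / (2 * (34 / 25 + 2 * (19 / 20)) * (34 / 25 - 21 / 20)) ≤ 0.3634 := by
      rw [div_le_iff₀ (by norm_num)]; linarith
    linarith
  have hprev := hc
  rcases le_or_gt y (23 / 20) with hc | hc
  · -- cell [1.05, 1.15]: P ≤ 3.7430, Q ≤ 0.4766, total 9.462
    have hP := term1_le_of_ge_us (by norm_num : (0 : ℝ) < 21 / 20) hprev.le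
    have hP' : Real.exp ((34 / 25) ^ 3) / (3 * (21 / 20) ^ 2) ≤ 3.7432000000000003 := by
      rw [div_le_iff₀ (by norm_num)]; linarith [hEus]
    have hQ := term2_le_gauss_of_le_us (by norm_num) hprev.le (hc.trans (by norm_num)) hV
    have hG : Real.sqrt (π / (34 / 25 + 2 * (21 / 20))) / 2 ≤ 0.47659999999999997 :=
      sqrt_pi_div_le (by norm_num) (by norm_num) (by norm_num)
    linarith
  have hprev := hc
  rcases le_or_gt y (5 / 4) with hc | hc
  · -- cell [1.15, 1.25]: P ≤ 3.1204, Q ≤ 0.4634, total 8.681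
    have hP := term1_le_of_ge_us (by norm_num : (0 : ℝ) < 23 / 20) hprev.le
    have hP' : Real.exp ((34 / 25) ^ 3) / (3 * (23 / 20) ^ 2) ≤ 3.1205000000000003 := by
      rw [div_le_iff₀ (by norm_num)]; linarith [hEus]
    have hQ := term2_le_gauss_of_le_us (by norm_num) hprev.le (hc.trans (by norm_num)) hV
    have hG : Real.sqrt (π / (34 / 25 + 2 * (23 / 20))) / 2 ≤ 0.4634 :=
      sqrt_pi_div_le (by norm_num) (by norm_num) (by norm_num)
    linarith
  have hprev := hc
  have hc := hhi
  -- cell [1.25, 1.36]: P ≤ 2.6411, Q ≤ 0.4512, total 8.055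
  have hP := term1_le_of_ge_us (by norm_num : (0 : ℝ) < 5 / 4) hprev.le
  have hP' : Real.exp ((34 / 25) ^ 3) / (3 * (5 / 4) ^ 2) ≤ 2.6412 := by
    rw [div_le_iff₀ (by norm_num)]; linarith [hEus]
  have hQ := term2_le_gauss_of_le_us (by norm_num) hprev.le (hc.trans (by norm_num)) hV
  have hG : Real.sqrt (π / (34 / 25 + 2 * (5 / 4))) / 2 ≤ 0.4512 :=
    sqrt_pi_div_le (by norm_num) (by norm_num) (by norm_num)
  linarith

/-- The `κ₁₂`-bound on the range no. 2 of `y`. [folklore] -/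
theorem kappa12_le_part2 {y V : ℝ} (hlo : 34 / 25 ≤ y) (hhi : y ≤ 8 / 5) (hV : 34 / 25 ≤ V) :
    Real.exp (-2 * y ^ 3) * (∫ u in (0 : ℝ)..34 / 25, Real.exp (3 * y ^ 2 * u))
      + 12 * ∫ u in (34 / 25 : ℝ)..V, Real.exp (-((u - y) ^ 2 * (u + 2 * y))) ≤ 10 := by
  have hEus := exp_cube_us_le
  rcases le_or_gt y (29 / 20) with hc | hc
  · -- cell [1.36, 1.45]: P ≤ 2.2304, left(T)+right ≤ 0.5279, total 8.565
    have hP := term1_le_of_gep_us (by norm_num) hlo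
    have hE := k12_expA_0
    have hP' : Real.exp (3 * (34 / 25) ^ 2 * (34 / 25) - 2 * (34 / 25) ^ 3) / (3 * (34 / 25) ^ 2) ≤ 2.2305 := by
      rw [div_le_iff₀ (by norm_num)]; linarith
    have hG2 : Real.sqrt (π / (3 * (34 / 25))) / 2 ≤ 0.4389 :=
      sqrt_pi_div_le (by norm_num) (by norm_num) (by norm_num)
    have hQ := term2_le_of_ge_taylor_us (by norm_num) hlo hc hV
    linarith
  have hprev := hc
  rcases le_or_gt y (3 / 2) with hc | hc
  · -- cell [1.45, 1.5]: P ≤ 1.8955, left(T)+right ≤ 0.5613, total 8.631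
    have hP := term1_le_of_gep_us (by norm_num) hprev.le
    have hE := k12_expA_1
    have hP' : Real.exp (3 * (29 / 20) ^ 2 * (34 / 25) - 2 * (29 / 20) ^ 3) / (3 * (29 / 20) ^ 2) ≤ 1.8957 := by
      rw [div_le_iff₀ (by norm_num)]; linarith
    have hG2 : Real.sqrt (π / (3 * (29 / 20))) / 2 ≤ 0.4251 :=
      sqrt_pi_div_le (by norm_num) (by norm_num) (by norm_num)
    have hQ := term2_le_of_ge_taylor_us (by norm_num) hprev.le hc hV
    linarith
  have hprev := hc
  rcases le_or_gt y (31 / 20) with hc | hc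
  · -- cell [1.5, 1.55]: P ≤ 1.6833, left(T)+right ≤ 0.5984, total 8.864
    have hP := term1_le_of_gep_us (by norm_num) hprev.le
    have hE := k12_expA_2
    have hP' : Real.exp (3 * (3 / 2) ^ 2 * (34 / 25) - 2 * (3 / 2) ^ 3) / (3 * (3 / 2) ^ 2) ≤ 1.6834 := by
      rw [div_le_iff₀ (by norm_num)]; linarith
    have hG2 : Real.sqrt (π / (3 * (3 / 2))) / 2 ≤ 0.4179 :=
      sqrt_pi_div_le (by norm_num) (by norm_num) (by norm_num)
    have hQ := term2_le_of_ge_taylor_us (by norm_num) hprev.le hc hV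
    linarith
  have hprev := hc
  have hc := hhi
  -- cell [1.55, 1.6]: P ≤ 1.4618, left(T)+right ≤ 0.6321, total 9.047
  have hP := term1_le_of_gep_us (by norm_num) hprev.le
  have hE := k12_expA_3
  have hP' : Real.exp (3 * (31 / 20) ^ 2 * (34 / 25) - 2 * (31 / 20) ^ 3) / (3 * (31 / 20) ^ 2) ≤ 1.462 := by
    rw [div_le_iff₀ (by norm_num)]; linarith
  have hG2 : Real.sqrt (π / (3 * (31 / 20))) / 2 ≤ 0.41109999999999997 :=
    sqrt_pi_div_le (by norm_num) (by norm_num) (by norm_num)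
  have hQ := term2_le_of_ge_taylor_us (by norm_num) hprev.le hc hV
  linarith

/-- The `κ₁₂`-bound on the range no. 3 of `y`. [folklore] -/
theorem kappa12_le_part3 {y V : ℝ} (hlo : 8 / 5 ≤ y) (hhi : y ≤ 37 / 20) (hV : 34 / 25 ≤ V) :
    Real.exp (-2 * y ^ 3) * (∫ u in (0 : ℝ)..34 / 25, Real.exp (3 * y ^ 2 * u))
      + 12 * ∫ u in (34 / 25 : ℝ)..V, Real.exp (-((u - y) ^ 2 * (u + 2 * y))) ≤ 10 := by
  have hEus := exp_cube_us_le
  rcases le_or_gt y (33 / 20) with hc | hc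
  · -- cell [1.6, 1.65]: P ≤ 1.2393, left(T)+right ≤ 0.6619, total 9.182
    have hP := term1_le_of_gep_us (by norm_num) hlo
    have hE := k12_expA_4
    have hP' : Real.exp (3 * (8 / 5) ^ 2 * (34 / 25) - 2 * (8 / 5) ^ 3) / (3 * (8 / 5) ^ 2) ≤ 1.2395 := by
      rw [div_le_iff₀ (by norm_num)]; linarith
    have hG2 : Real.sqrt (π / (3 * (8 / 5))) / 2 ≤ 0.4047 :=
      sqrt_pi_div_le (by norm_num) (by norm_num) (by norm_num)
    have hQ := term2_le_of_ge_taylor_us (by norm_num) hlo hc hV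
    linarith
  have hprev := hc
  rcases le_or_gt y (17 / 10) with hc | hc
  · -- cell [1.65, 1.7]: P ≤ 1.0241, left(T)+right ≤ 0.6873, total 9.272
    have hP := term1_le_of_gep_us (by norm_num) hprev.le
    have hE := k12_expA_5
    have hP' : Real.exp (3 * (33 / 20) ^ 2 * (34 / 25) - 2 * (33 / 20) ^ 3) / (3 * (33 / 20) ^ 2) ≤ 1.0242 := by
      rw [div_le_iff₀ (by norm_num)]; linarith
    have hG2 : Real.sqrt (π / (3 * (33 / 20))) / 2 ≤ 0.39849999999999997 :=
      sqrt_pi_div_le (by norm_num) (by norm_num) (by norm_num)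
    have hQ := term2_le_of_ge_taylor_us (by norm_num) hprev.le hc hV
    linarith
  have hprev := hc
  rcases le_or_gt y (7 / 4) with hc | hc
  · -- cell [1.7, 1.75]: P ≤ 0.8235, left(T)+right ≤ 0.7089, total 9.331
    have hP := term1_le_of_gep_us (by norm_num) hprev.le
    have hE := k12_expA_6
    have hP' : Real.exp (3 * (17 / 10) ^ 2 * (34 / 25) - 2 * (17 / 10) ^ 3) / (3 * (17 / 10) ^ 2) ≤ 0.8237 := by
      rw [div_le_iff₀ (by norm_num)]; linarith
    have hG2 : Real.sqrt (π / (3 * (17 / 10))) / 2 ≤ 0.3926 :=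
      sqrt_pi_div_le (by norm_num) (by norm_num) (by norm_num)
    have hQ := term2_le_of_ge_taylor_us (by norm_num) hprev.le hc hV
    linarith
  have hprev := hc
  rcases le_or_gt y (9 / 5) with hc | hc
  · -- cell [1.75, 1.8]: P ≤ 0.6434, left(T)+right ≤ 0.7279, total 9.378
    have hP := term1_le_of_gep_us (by norm_num) hprev.le
    have hE := k12_expA_7
    have hP' : Real.exp (3 * (7 / 4) ^ 2 * (34 / 25) - 2 * (7 / 4) ^ 3) / (3 * (7 / 4) ^ 2) ≤ 0.6435 := by
      rw [div_le_iff₀ (by norm_num)]; linarith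
    have hG2 : Real.sqrt (π / (3 * (7 / 4))) / 2 ≤ 0.38689999999999997 :=
      sqrt_pi_div_le (by norm_num) (by norm_num) (by norm_num)
    have hQ := term2_le_of_ge_taylor_us (by norm_num) hprev.le hc hV
    linarith
  have hprev := hc
  have hc := hhi
  -- cell [1.8, 1.85]: P ≤ 0.4877, left(T)+right ≤ 0.7465, total 9.445
  have hP := term1_le_of_gep_us (by norm_num) hprev.le
  have hE := k12_expA_8
  have hP' : Real.exp (3 * (9 / 5) ^ 2 * (34 / 25) - 2 * (9 / 5) ^ 3) / (3 * (9 / 5) ^ 2) ≤ 0.4878 := by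
    rw [div_le_iff₀ (by norm_num)]; linarith
  have hG2 : Real.sqrt (π / (3 * (9 / 5))) / 2 ≤ 0.3815 :=
    sqrt_pi_div_le (by norm_num) (by norm_num) (by norm_num)
  have hQ := term2_le_of_ge_taylor_us (by norm_num) hprev.le hc hV
  linarith

/-- The `κ₁₂`-bound on the range no. 4 of `y`. [folklore] -/
theorem kappa12_le_part4 {y V : ℝ} (hlo : 37 / 20 ≤ y) (hhi : y ≤ 11 / 5) (hV : 34 / 25 ≤ V) :
    Real.exp (-2 * y ^ 3) * (∫ u in (0 : ℝ)..34 / 25, Real.exp (3 * y ^ 2 * u))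
      + 12 * ∫ u in (34 / 25 : ℝ)..V, Real.exp (-((u - y) ^ 2 * (u + 2 * y))) ≤ 10 := by
  have hEus := exp_cube_us_le
  rcases le_or_gt y (19 / 10) with hc | hc
  · -- cell [1.85, 1.9]: P ≤ 0.3579, left(T)+right ≤ 0.7683, total 9.577
    have hP := term1_le_of_gep_us (by norm_num) hlo
    have hE := k12_expA_9
    have hP' : Real.exp (3 * (37 / 20) ^ 2 * (34 / 25) - 2 * (37 / 20) ^ 3) / (3 * (37 / 20) ^ 2) ≤ 0.3581 := by
      rw [div_le_iff₀ (by norm_num)]; linarith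
    have hG2 : Real.sqrt (π / (3 * (37 / 20))) / 2 ≤ 0.37629999999999997 :=
      sqrt_pi_div_le (by norm_num) (by norm_num) (by norm_num)
    have hQ := term2_le_of_ge_taylor_us (by norm_num) hlo hc hV
    linarith
  have hprev := hc
  rcases le_or_gt y (39 / 20) with hc | hc
  · -- cell [1.9, 1.95]: P ≤ 0.2540, left(G)+right ≤ 0.7617, total 9.394
    have hP := term1_le_of_gep_us (by norm_num) hprev.le
    have hE := k12_expA_10
    have hP' : Real.exp (3 * (19 / 10) ^ 2 * (34 / 25) - 2 * (19 / 10) ^ 3) / (3 * (19 / 10) ^ 2) ≤ 0.2542 := by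
      rw [div_le_iff₀ (by norm_num)]; linarith
    have hG2 : Real.sqrt (π / (3 * (19 / 10))) / 2 ≤ 0.3714 :=
      sqrt_pi_div_le (by norm_num) (by norm_num) (by norm_num)
    have hG1 : Real.sqrt (π / (34 / 25 + 2 * (19 / 10))) / 2 ≤ 0.3903 :=
      sqrt_pi_div_le (by norm_num) (by norm_num) (by norm_num)
    have hQ := (term2_le_of_ge_us (by norm_num) hprev.le hc hV).2
    linarith
  have hprev := hc
  rcases le_or_gt y (2) with hc | hc
  · -- cell [1.95, 2.0]: P ≤ 0.1741, left(G)+right ≤ 0.7532, total 9.212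
    have hP := term1_le_of_gep_us (by norm_num) hprev.le
    have hE := k12_expA_11
    have hP' : Real.exp (3 * (39 / 20) ^ 2 * (34 / 25) - 2 * (39 / 20) ^ 3) / (3 * (39 / 20) ^ 2) ≤ 0.1742 := by
      rw [div_le_iff₀ (by norm_num)]; linarith
    have hG2 : Real.sqrt (π / (3 * (39 / 20))) / 2 ≤ 0.3666 :=
      sqrt_pi_div_le (by norm_num) (by norm_num) (by norm_num)
    have hG1 : Real.sqrt (π / (34 / 25 + 2 * (39 / 20))) / 2 ≤ 0.3866 :=
      sqrt_pi_div_le (by norm_num) (by norm_num) (by norm_num)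
    have hQ := (term2_le_of_ge_us (by norm_num) hprev.le hc hV).2
    linarith
  have hprev := hc
  rcases le_or_gt y (21 / 10) with hc | hc
  · -- cell [2.0, 2.1]: P ≤ 0.1151, left(G)+right ≤ 0.7449, total 9.054
    have hP := term1_le_of_gep_us (by norm_num) hprev.le
    have hE := k12_expA_12
    have hP' : Real.exp (3 * (2) ^ 2 * (34 / 25) - 2 * (2) ^ 3) / (3 * (2) ^ 2) ≤ 0.1152 := by
      rw [div_le_iff₀ (by norm_num)]; linarith
    have hG2 : Real.sqrt (π / (3 * (2))) / 2 ≤ 0.362 :=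
      sqrt_pi_div_le (by norm_num) (by norm_num) (by norm_num)
    have hG1 : Real.sqrt (π / (34 / 25 + 2 * (2))) / 2 ≤ 0.38289999999999996 :=
      sqrt_pi_div_le (by norm_num) (by norm_num) (by norm_num)
    have hQ := (term2_le_of_ge_us (by norm_num) hprev.le hc hV).2
    linarith
  have hprev := hc
  have hc := hhi
  -- cell [2.1, 2.2]: P ≤ 0.0453, left(G)+right ≤ 0.7292, total 8.796
  have hP := term1_le_of_gep_us (by norm_num) hprev.le
  have hE : Real.exp (3 * (21 / 10) ^ 2 * (34 / 25) - 2 * (21 / 10) ^ 3) ≤ 0.5992 := by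
    have := exp_neg_le_of_quadratic (c := 1323/2500) (X := 0.5992) (by norm_num) (by norm_num) (by norm_num)
    convert this using 2; norm_num
  have hP' : Real.exp (3 * (21 / 10) ^ 2 * (34 / 25) - 2 * (21 / 10) ^ 3) / (3 * (21 / 10) ^ 2) ≤ 0.0454 := by
    rw [div_le_iff₀ (by norm_num)]; linarith
  have hG2 : Real.sqrt (π / (3 * (21 / 10))) / 2 ≤ 0.3532 :=
    sqrt_pi_div_le (by norm_num) (by norm_num) (by norm_num)
  have hG1 : Real.sqrt (π / (34 / 25 + 2 * (21 / 10))) / 2 ≤ 0.376 :=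
    sqrt_pi_div_le (by norm_num) (by norm_num) (by norm_num)
  have hQ := (term2_le_of_ge_us (by norm_num) hprev.le hc hV).2
  linarith

/-- The `κ₁₂`-bound on the range no. 5 of `y`. [folklore] -/
theorem kappa12_le_part5 {y V : ℝ} (hlo : 11 / 5 ≤ y) (hV : 34 / 25 ≤ V) :
    Real.exp (-2 * y ^ 3) * (∫ u in (0 : ℝ)..34 / 25, Real.exp (3 * y ^ 2 * u))
      + 12 * ∫ u in (34 / 25 : ℝ)..V, Real.exp (-((u - y) ^ 2 * (u + 2 * y))) ≤ 10 := by
  have hEus := exp_cube_us_le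
  rcases le_or_gt y (47 / 20) with hc | hc
  · -- cell [2.2, 2.35]: P ≤ 0.0184, left(G)+right ≤ 0.7145, total 8.592
    have hP := term1_le_of_gep_us (by norm_num) hlo
    have hE : Real.exp (3 * (11 / 5) ^ 2 * (34 / 25) - 2 * (11 / 5) ^ 3) ≤ 0.26689999999999997 := by
      have := exp_neg_le_of_quadratic (c := 968/625) (X := 0.26689999999999997) (by norm_num) (by norm_num) (by norm_num)
      convert this using 2; norm_num
    have hP' : Real.exp (3 * (11 / 5) ^ 2 * (34 / 25) - 2 * (11 / 5) ^ 3) / (3 * (11 / 5) ^ 2) ≤ 0.0185 := by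
      rw [div_le_iff₀ (by norm_num)]; linarith
    have hG2 : Real.sqrt (π / (3 * (11 / 5))) / 2 ≤ 0.34509999999999996 :=
      sqrt_pi_div_le (by norm_num) (by norm_num) (by norm_num)
    have hG1 : Real.sqrt (π / (34 / 25 + 2 * (11 / 5))) / 2 ≤ 0.3694 :=
      sqrt_pi_div_le (by norm_num) (by norm_num) (by norm_num)
    have hQ := (term2_le_of_ge_us (by norm_num) hlo hc hV).2
    linarith
  have hprev := hc
  rcases le_or_gt y (13 / 5) with hc | hc
  · -- cell [2.35, 2.6]: P ≤ 0.0059, left(G)+right ≤ 0.6941, total 8.335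
    have hP := term1_le_of_gep_us (by norm_num) hprev.le
    have hE : Real.exp (3 * (47 / 20) ^ 2 * (34 / 25) - 2 * (47 / 20) ^ 3) ≤ 0.0974 := by
      have := exp_neg_le_of_quadratic (c := 68479/20000) (X := 0.0974) (by norm_num) (by norm_num) (by norm_num)
      convert this using 2; norm_num
    have hP' : Real.exp (3 * (47 / 20) ^ 2 * (34 / 25) - 2 * (47 / 20) ^ 3) / (3 * (47 / 20) ^ 2) ≤ 0.006 := by
      rw [div_le_iff₀ (by norm_num)]; linarith
    have hG2 : Real.sqrt (π / (3 * (47 / 20))) / 2 ≤ 0.3339 :=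
      sqrt_pi_div_le (by norm_num) (by norm_num) (by norm_num)
    have hG1 : Real.sqrt (π / (34 / 25 + 2 * (47 / 20))) / 2 ≤ 0.36019999999999996 :=
      sqrt_pi_div_le (by norm_num) (by norm_num) (by norm_num)
    have hQ := (term2_le_of_ge_us (by norm_num) hprev.le hc hV).2
    linarith
  have hprev := hc
  rcases le_or_gt y (3) with hc | hc
  · -- cell [2.6, 3.0]: P ≤ 0.0013, left(G)+right ≤ 0.6637, total 7.966
    have hP := term1_le_of_gep_us (by norm_num) hprev.le
    have hE : Real.exp (3 * (13 / 5) ^ 2 * (34 / 25) - 2 * (13 / 5) ^ 3) ≤ 0.027 := by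
      have := exp_neg_le_of_quadratic (c := 4732/625) (X := 0.027) (by norm_num) (by norm_num) (by norm_num)
      convert this using 2; norm_num
    have hP' : Real.exp (3 * (13 / 5) ^ 2 * (34 / 25) - 2 * (13 / 5) ^ 3) / (3 * (13 / 5) ^ 2) ≤ 0.0015 := by
      rw [div_le_iff₀ (by norm_num)]; linarith
    have hG2 : Real.sqrt (π / (3 * (13 / 5))) / 2 ≤ 0.3175 :=
      sqrt_pi_div_le (by norm_num) (by norm_num) (by norm_num)
    have hG1 : Real.sqrt (π / (34 / 25 + 2 * (13 / 5))) / 2 ≤ 0.3462 :=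
      sqrt_pi_div_le (by norm_num) (by norm_num) (by norm_num)
    have hQ := (term2_le_of_ge_us (by norm_num) hprev.le hc hV).2
    linarith
  have hprev := hc
  -- cell [3.0, ∞): P ≤ 0.0002, Q/C ≤ 0.6224, total 7.469
  have hP := term1_le_of_gep_us (by norm_num) hprev.le
  have hE : Real.exp (3 * (3) ^ 2 * (34 / 25) - 2 * (3) ^ 3) ≤ 0.0061 := by
    have := exp_neg_le_of_quadratic (c := 432/25) (X := 0.0061) (by norm_num) (by norm_num) (by norm_num)
    convert this using 2; norm_num
  have hP' : Real.exp (3 * (3) ^ 2 * (34 / 25) - 2 * (3) ^ 3) / (3 * (3) ^ 2) ≤ 0.00039999999999999996 := by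
    rw [div_le_iff₀ (by norm_num)]; linarith
  have hG2 : Real.sqrt (π / (3 * (3))) / 2 ≤ 0.2956 :=
    sqrt_pi_div_le (by norm_num) (by norm_num) (by norm_num)
  have hG1 : Real.sqrt (π / (34 / 25 + 2 * (3))) / 2 ≤ 0.3268 :=
    sqrt_pi_div_le (by norm_num) (by norm_num) (by norm_num)
  have hQ := (term2_le_of_ge_us (by norm_num) hprev.le le_rfl hV).2
  linarith

/-- **The `κ`-lemma with `C = 12`.** For all `y ≥ 0` and `V ≥ 34/25`,
`e^{−2y³} ∫_0^{34/25} e^{3y²u} du + 12 ∫_{34/25}^{V} e^{−(u−y)²(u+2y)} du ≤ 10`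
(true supremum `≈ 8.84` near `y = 1.8`; twenty-five cells in five ranges).
[cite: Ford2002, Lemma 7.3 (proof; with the constant `C` of Theorem 2 replaced by `12`)] -/
theorem kappa12_le {y V : ℝ} (hy : 0 ≤ y) (hV : 34 / 25 ≤ V) :
    Real.exp (-2 * y ^ 3) * (∫ u in (0 : ℝ)..34 / 25, Real.exp (3 * y ^ 2 * u))
      + 12 * ∫ u in (34 / 25 : ℝ)..V, Real.exp (-((u - y) ^ 2 * (u + 2 * y))) ≤ 10 := by
  rcases le_or_gt y (34 / 25) with h1 | h1
  · exact kappa12_le_part1 hy h1 hV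
  rcases le_or_gt y (8 / 5) with h2 | h2
  · exact kappa12_le_part2 h1.le h2 hV
  rcases le_or_gt y (37 / 20) with h3 | h3
  · exact kappa12_le_part3 h2.le h3 hV
  rcases le_or_gt y (11 / 5) with h4 | h4
  · exact kappa12_le_part4 h3.le h4 hV
  · exact kappa12_le_part5 h4.le hV

/-- The `κ`-lemma with `C = 12` in the form consumed by the main argument: for `y ≥ 0`, `V ≥ 34/25`,
`e^{−2y³} (∫_0^{34/25} e^{3y²u} du + 12 ∫_{34/25}^{V} e^{3y²u − u³} du) ≤ 10`.
[cite: Ford2002, Lemma 7.3 (proof)] -/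
theorem kappa12_le' {y V : ℝ} (hy : 0 ≤ y) (hV : 34 / 25 ≤ V) :
    Real.exp (-2 * y ^ 3) * ((∫ u in (0 : ℝ)..34 / 25, Real.exp (3 * y ^ 2 * u))
      + 12 * ∫ u in (34 / 25 : ℝ)..V, Real.exp (3 * y ^ 2 * u - u ^ 3)) ≤ 10 := by
  have h := kappa12_le hy hV
  have e1 : Real.exp (-2 * y ^ 3) * (12 * ∫ u in (34 / 25 : ℝ)..V, Real.exp (3 * y ^ 2 * u - u ^ 3))
      = 12 * ∫ u in (34 / 25 : ℝ)..V, Real.exp (-((u - y) ^ 2 * (u + 2 * y))) := by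
    rw [mul_left_comm, ← intervalIntegral.integral_const_mul]
    congr 1
    refine integral_congr fun u _ ↦ ?_
    exact exp_neg_two_cube_mul_exp y u
  rw [mul_add, e1]
  exact h

end FordVK

end Literature.NumberTheory.LFunctions
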